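import Summits.QuantumFields.YangMills.Theorems.BalabanUVNodesN22AtRecordOfTermDataTableGermsRoad1LocatedRadii
import Summits.QuantumFields.YangMills.Theorems.BalabanUVNodesN10GenLastCouplingOfTermSectors
import Summits.QuantumFields.YangMills.Theorems.BalabanUVNodesN22GenLastCouplingSchemasOfHolo

/-!
# BalabanUVNodes ∕ node N22 = NE9 — ROAD 1 (max clause) AT THE RECORD FOR def-W1's (2.14) TERM DATA WITH THE FIRST-ORDER LAST-COUPLING ROW `hGt` DISCHARGED FROM THE
# PER-TERM COUPLING LETTERS OF A CONTINUED TERM FAMILY `Tc`, BY NAME: module J77 §1 (ROAD-1 socket of record) ∘ node N10's 109B §2 `lastCouplingSectors_ofTerms_of_termSectors`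
# (sector holomorphy + centred vertex bound of the CONTINUED generator `GenTower.ofTerms L (Tc K)`) ∘ module J59 §2 `genT1last_of_lastSectorHolo` (Cauchy at first order on the
# relative discs) ∘ §0 (agreement with `(𝔇 K).Gn` at real window couplings) — the last-coupling side of N22's ROAD-1 bill now lives on ANY term family agreeing with the datum's
# display on the real window (def-W1's designated one: `TermData214.continuedTF`, agreement by the unscaled-field law); ROAD 1 carries NO node-N18 rate

Cell `pub-ymgap`, HUMAN RULING D-0062 (Track A), R134 seat `pub-ymgap-dag-n22-c` (strategy s1: «the history-Lipschitz estimate (2.40)–(2.41) p. 21 of [II] on the W1 object»), generation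
20, module J81.  THEOREMS ONLY (no `def`, no `sorry`, standard axioms); `--kind proof --supports stmt-QuantumFields-27366 --as helper` (K3⁸ `SpineGivenEndpointR13SepCoPHV`), COUNT-NEUTRAL.
Imports this lane's module J77 `…N22AtRecordOfTermDataTableGermsRoad1LocatedRadii` (ROAD-1 socket of record, p679189), node N10's module 109B `…N10GenLastCouplingOfTermSectors` (seat
`pub-ymgap-dag-n10-c` g20, p681822; §2 is GENERIC in the term family — its header l.11: «ROAD 1's first-order row `hGt` follows by the N22 lane's `genT1last_of_lastSectorHolo`») and
this lane's module J59 `…N22GenLastCouplingSchemasOfHolo` (g18, p661822).  Nothing re-declared; consumed BY NAME.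

WHY — AND WHY A CONTINUED FAMILY.  ROAD 1 (modules J55∕J61∕J65∕J71∕J73∕J77: first order only, the MAX clause `ω₁ ≤ μ`, `4M_b c_w∕ϱ ≤ μ`, `μ ≤ ℓ.ω`; NO node-N18 rate letter, NO
`θ₅ ≤ ω²`) displayed since J55 the REAL first-order last-coupling Lipschitz row `hGt : ‖((𝔇 K).Gn k).E t old φ X − ((𝔇 K).Gn k).E t′ old φ X‖ ≤ e^{−r₁ d_{k+1}(X)}·lam·|t − t′|`
UNIFORMLY on `]0, γ]` ([I] p. 263∕266, qualitative in print) — a statement about the generator AT REAL COUPLINGS.  Any function holomorphic on the sectors `O K ⊇ closedBall s (c_S·s)`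
that AGREES with `((𝔇 K).Gn k).E` at the real window couplings and carries the CENTRED quadratic bound `‖E z − V‖ ≤ B_q e^{−r₁ d} s²` there delivers `hGt` by Cauchy on the circle of
radius `c_S·s` (`‖E′(s)‖ ≤ (B_qγ∕c_S)·e^{−r₁ d}`, uniform in `s`) and the real mean value along the segment (module J59 §2).  The datum's OWN complex-coupling values `z ↦ (𝔇 K k).TF Z s z
old φ` (module J79's carrier) are the wrong place to ask holomorphy: def-W1's unscaled-field law `UnscaledFieldLawOn` (`Node00/HistoryTermDatum214WindowDilated` §1) reads the REAL
window only and leaves the complex-coupling fields free (its inhabitant `ofUnscaled`, §6, extends by `Re s`), and def-W1 DESIGNATES the holomorphic continuation in the last coupling: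
`TermData214.continuedTF χu χcu 𝒲 𝒪 γ` (§4–§5, the window-dilated member read from base point `γ`; `continuedTF_ofReal_eq_TF`: agreement with `TF` at every real window coupling
UNDER THE LAW; «its holomorphy on the relative sector staying the consumers' theorem»).  THIS FILE therefore states the four per-term letter families — (TS-holo) `hTh`, (TS-226)
`hT226`, the z-free centre `T₀` with (TS-226₀) `hT₀`, the centred vertex letter (TS-centred) `hTq` — for a DISPLAYED term family `Tc : (K : ℕ) → GenTermFun (F.P K) 𝔸 M L` with the
agreement row `hagree : Tc K k Z s ↑t old φ = (𝔇 K k).TF Z s ↑t old φ` (`t ∈ ]0,γ]`, on the class, the table, the polymers `Z ⊆ X` and the terms).  Instances: `Tc := fun K => (𝔇 K).TF`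
(`hagree := rfl`; module J79's carrier) and `Tc K := (𝔇 K).continuedTF (χu K) (χcu K) (𝒲 K) (𝒪 K) θ.γ` (`hagree` := `continuedTF_ofReal_eq_TF (hlaw K)` — DISCHARGED by the bill's own
law; module J81c).  Node N10's 109B §2 turns the letters into the sector datum of the continued generator `GenTower.ofTerms L (Tc K)` (`hholS`; `hbdS` with
`V := (GenTower.ofTerms L (centre terms) k).E 0 old φ X`, `B_q' = 2·(e·9·64·K₀(64,8)²·(2C₃ε₁))·C_q·(1+c_S)²`, rate `r₁`, weakened by the displayed `B_q' ≤ B_q`); J59 §2 gives the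
first-order row for that generator at real couplings; §0 (`StepGen.ofTerms_E` + `locE_congr` under `hagree`) rewrites it as J77 §1's `hGt` for `(𝔇 K).Gn` with
`lam K k := B_q·θ.γ∕c_S`; J77's `hlam : lam ≤ ℓ₁` becomes the numeric row `hlamq : B_q·θ.γ∕c_S ≤ ℓ₁`.
* §0 `E_ofTerms_congr_of_subset` — (2.13) of the term-indexed generator reads the term values on the polymers `Z ⊆ X` only.
* §1 ★★★ `ne9_EA_objectsOfRecord₁₃_of_termDataTableGermsLocatedRadiiTermSectorsRoad1Max` — binder diff vs J77 §1: `hGt hlam` OUT; `O hO hcS hBq hballS hsmall2 Tc hagree T₀ hCq hBqv hTh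
  hT226 hT₀ hTq hlamq` IN (J79 §1's letter shapes with `(𝔇 K k).TF Z s z old φ ↦ Tc K k Z s z old φ`).
* §2 ★★★ socket `n22At_u3OfRecord₁₃_of_termDataTableGermsLocatedRadiiTermSectorsRoad1Max` (dag-n27-c's `h22` row).
THE N22 ROAD-1 BILL AT def-W1's TERM DATA AFTER J81 — every analytic input a per-term ∕ per-step located row or a law: (1.21) `hlim`; W1-20's law `hloc` at the run towers of
`(𝔇 K).Gn`; NODE A's located (2.26) records `hι` (N10 per-slice form, τ-radii margin; take `old₀ := 0`) and `hloc18` (N18 per-step form — used for `RecAdmissible` and the (2.38) pair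
only, NOT for a rate); def-W1's laws (`UnscaledFieldLawOn`, `ReadsBy` + atom regularity, `MapsToTables … univ` on windows `W ⊇ sp`, `𝒲` measurable); a continued term family `Tc` with
`hagree` and its PER-TERM complex-last-coupling letters on the sectors `O K`: `hTh`, `hT226`, centre `T₀` with `hT₀`, centred vertex `hTq` (UNPRINTED as an estimate — this lane's
census since g6, desk ME #17 «nowhere — inspection-level»; at `Tc := continuedTF` the producers are the window-dilated road: `B13Term214WindowDilated` §4, this lane's
`…N22W1RelCentredSectorOfWindowDilated`, `B13Term214Centred` ∕ `B13Bound226Centred`); chart DATA (`Ec ι Φ U`, `hU hrU hΦhol hΦemb hΦsp`, site weights + tails); numerics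
(`Lemma3Numerics`, `8 ≤ L = c.L`, `1 ≤ κ₁`, `α₆ ≠ 0`, `0 ≤ C₃ε₁`, [KP86] clauses at `C₃ε₁` (strict) and `2C₃ε₁`, renewals `… ≤ M_b`, `… ≤ E₀`, `B_q' ≤ B_q`, `0 ≤ C_q`, `0 < c_S`, `0 ≤ B_q`,
weights `0 < b ≤ aw ≤ c_w`, `aw K k j ≤ c_w ω₁^{k−j}`, `κ ≤ r₁`, `c_w E₀ + ϱ < R`); ROAD-1 rows (`B_q·γ∕c_S ≤ ℓ₁`, `0 ≤ ℓ₁`, `0 ≤ ω₁`, `ω₁ ≤ μ`, `4M_b c_w∕ϱ ≤ μ`, `μ ≤ ℓ.ω`, `ℓ.κ ≤ δ₁`,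
`hrow`).

HONEST FRAMING (binding).  Count-neutral COMPOSITION of tree theorems BY NAME (J77 §1; n10-c 109B §2 ∘ 109A; J59 §2; `ofTerms_E` + `locE_congr`); `Tc`, `hagree`, `hTh hT226 hT₀
hTq`, the located records, the laws, the chart data, the numerics and every other binder are DISPLAYED HYPOTHESES (GAPS G-ne9p2-5 ∕ G-t4-U3-1 sit in per-term ∕ per-step rows: [II]
(2.14)–(2.15) p. 15 ∕ (2.26) p. 17 read in the complex last coupling with a centre, [I] p. 263 «(or analytic)», p. 267 «B = g_kB′»); NO estimate of Bałaban's is proved or asserted;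
nothing of the record is constructed or claimed to meet the displayed inputs.  N18, N10 and N22 are NOT discharged (typed 28∕28; count 7∕27 per dag-lead TABLE — N22 unchanged); K3⁸
OPEN and NOT claimed; NE9 ∕ NE5 NOT IN PRINT for d = 4; no count claim; one finite 𝕋⁴ programme at fixed ε — R4 closes the CONDITIONAL rung `BalabanLadder.UV` only; NOTHING about the
continuum limit, ℝ⁴, infinite volume, OS axioms, a mass gap or the Clay problem is proved or claimed.  References (TYPES only): [II] = Bałaban, CMP 116 (1988) (1.41) p. 11, (2.13)–(2.15)
pp. 14–15, (2.16)–(2.22) p. 16, (2.26) p. 17, Lemma 3 (2.38) p. 20, (2.39)–(2.41) p. 21; [I] = CMP 109 (1987) (0.23)–(0.24) pp. 256–257, Thm 1 p. 259, (1.17)–(1.18) p. 263, p. 266,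
(2.9)–(2.13) pp. 266–268; [13] (1.43); Kotecký–Preiss, CMP 103 (1986) Thm p. 492, p. 493; King, CMP 102 (1986) Lemma 4.5 (4.38).
-/

noncomputable section

open Set Metric
open scoped BigOperators

namespace YMDAG.N22.KernelFading

open Literature.MathematicalPhysics.QuantumFieldTheory.Balaban1983to89
open Literature.MathematicalPhysics.QuantumFieldTheory.Balaban1983to89.T4Continuum (T4Family ULoop)
open Literature.MathematicalPhysics.QuantumFieldTheory.Balaban1983to89.T4OutputRate (Window NE9)
open Literature.MathematicalPhysics.QuantumFieldTheory.Balaban1983to89.TreeLengthTorus (TPt TDom tsys torusTreeLen)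
open Literature.MathematicalPhysics.QuantumFieldTheory.Balaban1983to89.B9Thm37GlueTorus (tdist1)
open Literature.MathematicalPhysics.QuantumFieldTheory.Balaban1983to89.B12TreeDecay (K₀ kappa₀)
open Literature.MathematicalPhysics.QuantumFieldTheory.Balaban1983to89.B12Decay510 (delta1)
open Literature.MathematicalPhysics.QuantumFieldTheory.Balaban1983to89.B12Decay510Window (K₁)
open Literature.MathematicalPhysics.QuantumFieldTheory.Balaban1983to89.B12Decay510Torus (distCT nearT)
open Literature.MathematicalPhysics.QuantumFieldTheory.Balaban1983to89.B13Lemma3TorusData (TBond)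
open Literature.MathematicalPhysics.QuantumFieldTheory.Balaban1983to89.B13Lemma3TorusTerms (terms weight)
open Literature.MathematicalPhysics.QuantumFieldTheory.Balaban1983to89.B13Lemma3TorusSocket (Lemma3Numerics)
open Literature.MathematicalPhysics.QuantumFieldTheory.Balaban1983to89.B13OlderTermsTableGerms (Pot cv ρ)
open Literature.MathematicalPhysics.QuantumFieldTheory.Balaban1983to89.Node00 (Stage13Params Stage13HParams U3Letters₁₁ MatA)
open Literature.MathematicalPhysics.QuantumFieldTheory.Balaban1983to89.Node00.Sect2 (domSys domCount CPair)
open Literature.MathematicalPhysics.QuantumFieldTheory.Balaban1983to89.Node00.W1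
open Literature.MathematicalPhysics.QuantumFieldTheory.Balaban1983to89.Node00.LocalizedSum17 (ReadingMaps Localizes17OfRecord₁₃)
open Literature.MathematicalPhysics.QuantumFieldTheory.Balaban1983to89.Node00.U3OfKernels (histPrefix objectsOfRecord₁₃)
open Literature.MathematicalPhysics.QuantumFieldTheory.Balaban1983to89.Node00.U3KernelLetters (PolLimitsExistOfRecord₁₃)
open YMDAG.UVSplit (N22At u3OfRecord₁₃ RateReading₁₃CoPH rateCarriersOfRecord₁₃CoPH)
open YMDAG.N22.AtKernels (n22At_u3OfRecord₁₃_objectsOfRecord₁₃_iff)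
open YMDAG.N10 (termReading226_tableGerms_of_inputs226Holo_tauRadii)
open Summit.QuantumFields.YangMills.BalabanUVNodes.N18HLayerW1TermInputs226Chain (recAdmissible_Gn_of_inputs226Holo stepGen_Gn_of_inputs226Holo)
open YMDAG.N18.W1Reading (hLayer_runTowers_toClusterTower_of_stepGen)
open YMDAG.N22.AtRecordOfPrintedSlots (differentiableOn_E_comp_of_printedSlots ball_mem_sp_of_spaceClause)

open YMDAG.N10 (lastCouplingSectors_ofTerms_of_termSectors)
open YMDAG.N22.TermRecursion (genT1last_of_lastSectorHolo)
open Literature.MathematicalPhysics.QuantumFieldTheory.Balaban1983to89.B13Resummation (locE_congr)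

open scoped Matrix Matrix.Norms.L2Operator

variable (F : T4Family) (N : ℕ) [NeZero N] {𝔸 : Type} [NormedRing 𝔸] [NormedAlgebra ℂ 𝔸]

/-! ## §0 (2.13) of the term-indexed generator reads the term VALUES on the polymers inside `X` only -/

open Classical in
/-- **(2.13) OF THE TERM-INDEXED GENERATOR DEPENDS ON THE TERM VALUES ON `Z ⊆ X` ONLY**: two term functionals taking the same values at `(t, old, φ)` resp. `(t′, old′, φ′)` on the
terms `s ∈ terms L M Z` of every polymer `Z ⊆ X` create the same `E^{(k+1)}(X)` — `StepGen.ofTerms_E` (one `locE` literal over the term sums) + `B13Resummation.locE_congr`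
(the Kotecký–Preiss literal at `X` reads the activities of the `Z ⊆ X` only).  The `Z ⊆ X`-guarded sharpening of this lane's `YMDAG.N22.W1.E_ofTerms_congr`; used below to transport
the continued generator `GenTower.ofTerms L (Tc K)` to `(𝔇 K).Gn` at real window couplings. [cite: Balaban1988RG2Cluster, (2.13)-(2.14) pp.14-15 (bookkeeping)] -/
theorem E_ofTerms_congr_of_subset {P : Params} {𝔹 : Type*} {M' : ℕ} [NeZero M'] {k : ℕ} (L : ℕ) [NeZero L] {T T' : TermFun P 𝔹 M' k L} {t t' : ℂ}
    {old old' : OlderTerms P 𝔹 M' k} {φ φ' : CPair P 𝔹} (X : (domSys P M' (k + 1)).Dom)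
    (h : ∀ Z : (domSys P M' (k + 1)).Dom, Subtype.val Z ⊆ Subtype.val X → ∀ s ∈ terms L M' Z, T Z s t old φ = T' Z s t' old' φ') :
    (StepGen.ofTerms L T).E t old φ X = (StepGen.ofTerms L T').E t' old' φ' X := by
  rw [ofTerms_E, ofTerms_E]
  exact locE_congr _ fun Z hZ => Finset.sum_congr rfl (h Z hZ)

/-! ## §1 ★★★ K3's `h9` on ROAD 1 (max clause) for def-W1's term data: J77 §1 with the first-order last-coupling row `hGt` DISCHARGED from the per-term coupling letters of a CONTINUED term family `Tc` (109B §2 ∘ J59 §2 ∘ §0) -/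

open Classical Finset in
/-- ★★★ **K3's `h9` ON ROAD 1 (MAX CLAUSE) FOR def-W1's TERM DATA — FIRST-ORDER LAST-COUPLING ROW FROM THE PER-TERM COUPLING LETTERS OF A CONTINUED TERM FAMILY**: module J77 §1
with `hGt` := §0-transport (`hagree`) of `genT1last_of_lastSectorHolo (GenTower.ofTerms L (Tc K)) … (lastCouplingSectors_ofTerms_of_termSectors … Tc …).1 ((…).2.2, then B_q' ≤ B_q)` at
`lam K k := B_q·θ.γ∕c_S` (n10-c 109B §2 at `T := Tc`, `Adm := AdmHist ∧ old 0 = 0`, `spX := sp K (k+1)`; J59 §2's Cauchy estimate on `closedBall s (c_S·s)`).  New displayed rows: `hO`, `hcS`,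
`hBq`, `hballS`, `hsmall2`, the continued family `Tc` with `hagree` (agreement with `(𝔇 K k).TF` at real window couplings), centre `T₀` with `hT₀`, `hCq`, `hBqv`, per-term coupling letters
`hTh hT226 hTq` of `Tc`, `hlamq`.  NO node-N18 rate letter.  LOCATED (hypothesis form; the per-term centred vertex letter is unprinted); N22 NOT discharged. [folklore] -/
theorem ne9_EA_objectsOfRecord₁₃_of_termDataTableGermsLocatedRadiiTermSectorsRoad1Max (θ : Stage13Params F N) (ℓ : U3Letters₁₁) (hs : ℓ.Signs) (hγ : 0 < θ.γ) (hlim : PolLimitsExistOfRecord₁₃ F N θ)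
    (m' : ℕ) (M : ℕ) [NeZero M] (hM : M = F.L ^ m')
    {c₀ : B13.Consts} {L : ℕ} [NeZero L] (𝔇 : (K : ℕ) → TermData214 c₀ (F.P K) 𝔸 M L) (emb : ReadingMaps F (MatA N) 𝔸)
    (hloc : Localizes17OfRecord₁₃ F N θ (fun K => truncRun K (toClusterTower (𝔇 K).Gn)) emb)
    (sp : (K j : ℕ) → (domSys (F.P K) M j).Dom → Set (CPair (F.P K) 𝔸))
    (hsp : ∀ (K j : ℕ) (Y : (domSys (F.P K) M j).Dom), IsOpen (sp K j Y))
    {κ δ₀ B₃ r ℓ₁ R E₀ ϱ Mb cw ω₁ μ r₁ cS Bq : ℝ} {aw : ℕ → ℕ → ℕ → ℝ}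
    (hκ₀ : kappa₀ (4 * 2 ^ 4) (2 * 4) ≤ κ / 2) (hδ₀ : 0 < δ₀) (hB₃ : 0 ≤ B₃) (hr : 0 < r) (hκE : κ ≤ r₁) (hE₀ : 0 ≤ E₀)
    (big : (K j : ℕ) → (domSys (F.P K) M j).Dom → Set (CPair (F.P K) 𝔸))
    (hbigo : ∀ (K k : ℕ) (Z : (domSys (F.P K) M (k + 1)).Dom), IsOpen (big K (k + 1) Z))
    (hrestr : ∀ (K k : ℕ), SpRestr (sp K (k + 1))) (hbig : ∀ (K k : ℕ) (Z : (domSys (F.P K) M (k + 1)).Dom), sp K (k + 1) Z ⊆ big K (k + 1) Z)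
    (c : B13.Consts) (hL : 8 ≤ c.L) (hLc : c.L = L) (hκ₁ : 1 ≤ c.κ₁) (hα₆ : c.α₆ ≠ 0) {a a₂ a₂' a₅ Aabs : ℝ} (hN : Lemma3Numerics c M ((c.L : ℝ) / 2) a a₂ a₂' a₅ Aabs)
    {D : ℕ → Set ℂ}
    (hloc18 : ∀ (K k : ℕ), ∀ s ∈ D K, ∀ old : OlderTerms (F.P K) 𝔸 M k,
      (∀ (j : Fin (k + 1)) (Y : (domSys (F.P K) M j).Dom), ∀ ψ ∈ sp K j Y, ‖old j Y ψ‖ ≤ E₀ * Real.exp (-(r₁ * (domSys (F.P K) M j).dj Y))) →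
      (∀ (j : Fin (k + 1)) (Y : (domSys (F.P K) M j).Dom), AnalyticOnNhd ℂ (old j Y) (sp K j Y)) →
      ∀ (Z : (domSys (F.P K) M (k + 1)).Dom), ∀ t ∈ terms L M Z, ∀ φ₁ ∈ big K (k + 1) Z, ∃ ι : (𝔇 K k).Inputs226Holo c Z t s old φ₁ a a₅,
        (∀ φ ∈ big K (k + 1) Z, ∀ i j, DifferentiableOn ℂ (fun σ => (𝔇 K k).A Z t φ σ i j) {σ | ∀ j, σ j ∈ ι.Uσ}) ∧
        (∀ φ ∈ big K (k + 1) Z, ∀ i j, DifferentiableOn ℂ (fun σ => ((𝔇 K k).𝒦 Z t).G2 σ ((𝔇 K k).uOf Z t φ) i j) {σ | ∀ j, σ j ∈ ι.Uσ}) ∧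
        (∀ σ : TPt (F.P K).d (domCount (F.P K) M (k + 1)) → ℂ, (∀ j, σ j ∈ ι.Uσ) → ∀ i j, DifferentiableOn ℂ (fun φ => (𝔇 K k).A Z t φ σ i j) (big K (k + 1) Z)) ∧
        (∀ σ : TPt (F.P K).d (domCount (F.P K) M (k + 1)) → ℂ, (∀ j, σ j ∈ ι.Uσ) →
          ∀ i j, DifferentiableOn ℂ (fun φ => ((𝔇 K k).𝒦 Z t).G2 σ ((𝔇 K k).uOf Z t φ) i j) (big K (k + 1) Z)) ∧
        (∀ Y B, DifferentiableOn ℂ (fun φ => (𝔇 K k).𝒱 Z t s old φ Y B) (big K (k + 1) Z)) ∧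
        (∀ φ ∈ big K (k + 1) Z, ∀ Y, Measurable ((𝔇 K k).𝒱 Z t s old φ Y)) ∧
        (∀ φ ∈ big K (k + 1) Z, ∀ σ : TPt (F.P K).d (domCount (F.P K) M (k + 1)) → ℂ, (∀ j, σ j ∈ ι.Uσ) → ((𝔇 K k).A Z t φ σ).IsSymm) ∧
        (∀ φ ∈ big K (k + 1) Z, ∀ σ : TPt (F.P K).d (domCount (F.P K) M (k + 1)) → ℂ, (∀ j, σ j ∈ ι.Uσ) → (((𝔇 K k).A Z t φ σ).map Complex.re).PosDef) ∧
        (∀ φ ∈ big K (k + 1) Z, ∀ τ : TDom (F.P K).d (L * domCount (F.P K) M (k + 1)) → ℂ, (∀ Y, τ Y ∈ ι.Uτ Y) →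
          ∀ B, ∑ Y ∈ t.1, ‖τ Y‖ * ‖(𝔇 K k).𝒱 Z t s old φ Y B‖ ≤ ι.a₂₀ / 2 * (B ⬝ᵥ B) + ι.w) ∧
        (∀ φ ∈ big K (k + 1) Z, ∀ σ : TPt (F.P K).d (domCount (F.P K) M (k + 1)) → ℂ, (∀ j, σ j ∈ ι.Uσ) → ∀ b j, ‖((𝔇 K k).𝒦 Z t).G2 σ ((𝔇 K k).uOf Z t φ) b j‖ ≤
            ι.KG * Real.exp (-(ι.kap * tdist1 (𝔇 K k).Nf (((𝔇 K k).𝒦 Z t).locΛ b) (((𝔇 K k).𝒦 Z t).locN j)))) ∧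
        (∀ φ ∈ big K (k + 1) Z, ∀ σ : TPt (F.P K).d (domCount (F.P K) M (k + 1)) → ℂ, (∀ j, σ j ∈ ι.Uσ) → ∀ b b', ‖((𝔇 K k).A Z t φ σ)⁻¹ b b'‖ ≤
            ι.KCs * Real.exp (-(ι.kap * tdist1 (𝔇 K k).Nf (((𝔇 K k).𝒦 Z t).locΛ b) (((𝔇 K k).𝒦 Z t).locΛ b')))) ∧
        (∀ φ ∈ big K (k + 1) Z, ∀ σ : TPt (F.P K).d (domCount (F.P K) M (k + 1)) → ℂ, (∀ j, σ j ∈ ι.Uσ) →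
          ∀ b j, ‖(((𝔇 K k).𝒦 Z t).G2 σ ((𝔇 K k).uOf Z t φ) - ((𝔇 K k).𝒦 Z t).Γ₀.map (algebraMap ℝ ℂ)) b j‖ ≤
            ι.θΓ * Real.exp (-(ι.kap * tdist1 (𝔇 K k).Nf (((𝔇 K k).𝒦 Z t).locΛ b) (((𝔇 K k).𝒦 Z t).locN j)))) ∧
        (∀ φ ∈ big K (k + 1) Z, ∀ σ : TPt (F.P K).d (domCount (F.P K) M (k + 1)) → ℂ, (∀ j, σ j ∈ ι.Uσ) →
          ∀ b b', ‖(((𝔇 K k).A Z t φ σ)⁻¹ - ((𝔇 K k).𝒦 Z t).C.map (algebraMap ℝ ℂ)) b b'‖ ≤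
            ι.θC * Real.exp (-(ι.kap * tdist1 (𝔇 K k).Nf (((𝔇 K k).𝒦 Z t).locΛ b) (((𝔇 K k).𝒦 Z t).locΛ b')))) ∧
        (∀ φ ∈ big K (k + 1) Z, ∀ σ : TPt (F.P K).d (domCount (F.P K) M (k + 1)) → ℂ, (∀ j, σ j ∈ ι.Uσ) →
          ∀ b b', ‖((𝔇 K k).A Z t φ σ - ((𝔇 K k).𝒦 Z t).C⁻¹.map (algebraMap ℝ ℂ)) b b'‖ ≤
            ι.θE * Real.exp (-(ι.kap * tdist1 (𝔇 K k).Nf (((𝔇 K k).𝒦 Z t).locΛ b) (((𝔇 K k).𝒦 Z t).locΛ b')))))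
    (hD : ∀ K, ∀ t ∈ Ioc (0 : ℝ) θ.γ, ((t : ℝ) : ℂ) ∈ D K)
    {S : ℕ → ℕ → Type} [∀ K k, MeasurableSpace (S K k)] [∀ K k, TopologicalSpace (S K k)] [∀ K k, OpensMeasurableSpace (S K k)]
    (χu χcu : (K k : ℕ) → (𝔇 K k).UnscaledChi) (𝒲 : (K k : ℕ) → (𝔇 K k).UnscaledWilson) (𝒪 : (K k : ℕ) → (𝔇 K k).UnscaledOlder)
    (Rd : (K k : ℕ) → (Z : (domSys (F.P K) M (k + 1)).Dom) → (t : TermLabel (F.P K) M k L) → (𝔇 K k).ReadingAtoms Z t (S K k))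
    (W : (K k : ℕ) → (domSys (F.P K) M (k + 1)).Dom → TermLabel (F.P K) M k L → Set (CPair (F.P K) 𝔸))
    (hlaw : ∀ K, (𝔇 K).UnscaledFieldLawOn (χu K) (χcu K) (𝒲 K) (𝒪 K) θ.γ) (hread : ∀ K k, (𝔇 K k).ReadsBy (𝒪 K k) (Rd K k))
    (hmaps : ∀ (K k : ℕ) (Z : (domSys (F.P K) M (k + 1)).Dom) (t : TermLabel (F.P K) M k L), (Rd K k Z t).MapsToTables (sp K) (W K k Z t) univ)
    (hW : ∀ (K k : ℕ) (X Z : (domSys (F.P K) M (k + 1)).Dom), Subtype.val Z ⊆ Subtype.val X → ∀ s ∈ terms L M Z, sp K (k + 1) X ⊆ W K k Z s)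
    (hcont : ∀ (K k : ℕ) (Z : (domSys (F.P K) M (k + 1)).Dom) (t : TermLabel (F.P K) M k L), (Rd K k Z t).CfgContinuous)
    (hjc : ∀ (K k : ℕ) (Z : (domSys (F.P K) M (k + 1)).Dom) (t : TermLabel (F.P K) M k L), (Rd K k Z t).CfgJointContinuous)
    {Ck mk : ℝ} (hK : ∀ (K k : ℕ) (Z : (domSys (F.P K) M (k + 1)).Dom) (t : TermLabel (F.P K) M k L), (Rd K k Z t).KernelBounded Ck)
    (hμ : ∀ (K k : ℕ) (Z : (domSys (F.P K) M (k + 1)).Dom) (t : TermLabel (F.P K) M k L), (Rd K k Z t).FiniteMass mk) (hCk : 0 ≤ Ck) (hmk : 0 ≤ mk)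
    (hWm : ∀ (K k : ℕ) (Z : (domSys (F.P K) M (k + 1)).Dom) (t : TermLabel (F.P K) M k L) (φ : CPair (F.P K) 𝔸) (Y : TDom (F.P K).d (L * domCount (F.P K) M (k + 1))),
      Measurable fun B : ((𝔇 K k).𝒦 Z t).Λ → ℝ => 𝒲 K k Z t φ Y B)
    {b : ℝ} (hb : 0 < b) (hbaw : ∀ K k j, b ≤ aw K k j)
    (hι : ∀ (K k : ℕ), ∀ t ∈ Ioc (0 : ℝ) θ.γ, ∀ (X : (domSys (F.P K) M (k + 1)).Dom), ∀ φ ∈ sp K (k + 1) X,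
      ∀ Z : (domSys (F.P K) M (k + 1)).Dom, Subtype.val Z ⊆ Subtype.val X → ∀ s ∈ terms L M Z,
        ∃ old₀ ∈ AdmHist (sp K) E₀ r₁ k, ∃ ι : (𝔇 K k).Inputs226Holo c Z s ((t : ℝ) : ℂ) old₀ φ a a₅, ∃ w₀ : ℝ,
          (∀ τ : TDom (F.P K).d (L * domCount (F.P K) M (k + 1)) → ℂ, (∀ Y, τ Y ∈ ι.Uτ Y) → ∀ B : ((𝔇 K k).𝒦 Z s).Λ → ℝ,
            ∑ Y ∈ s.1, ‖τ Y‖ * ‖(𝔇 K k).𝒱 Z s ((t : ℝ) : ℂ) old₀ φ Y B‖ ≤ ι.a₂₀ / 2 * (B ⬝ᵥ B) + w₀) ∧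
          w₀ + (∑ Y ∈ s.1, ((B13Bound143.invTau c ((tsys (F.P K).d (L * domCount (F.P K) M (k + 1))).dj Y))⁻¹ + (𝔇 K k).r + 2)) *
            ((∑ _j : Fin (k + 1), ∑ _X : (domSys (F.P K) M _j).Dom, Ck) * mk * (E₀ + b⁻¹ * R)) ≤ ι.w)
    (hA0 : 0 ≤ c.C3act * c.ε₁) (hr₁ : 0 ≤ r₁) (hrate : r₁ + 2 * (64 * Real.log 162) + 2 ≤ (1 - 8 * c.δ) * ((c.L : ℝ) / 2) * c.κ)
    (hKP : c.C3act * c.ε₁ * Real.exp (5 * r₁ + 1) * K₀ 64 8 * 9 * 64 < 1) (hrenew : Real.exp 1 * 9 * 64 * K₀ 64 8 ^ 2 * (c.C3act * c.ε₁) ≤ Mb)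
    (hrenewE : Real.exp 1 * 9 * 64 * K₀ 64 8 ^ 2 * (c.C3act * c.ε₁) ≤ E₀)
    (hawcw : ∀ K k j, aw K k j ≤ cw) (hawω : ∀ K k j, j ≤ k → aw K k j ≤ cw * ω₁ ^ (k - j)) (hϱ : 0 < ϱ) (hR : cw * E₀ + ϱ < R)
    (O : ℕ → Set ℂ) (hO : ∀ K, IsOpen (O K)) (hcS : 0 < cS) (hBq : 0 ≤ Bq)
    (hballS : ∀ K, ∀ s ∈ Ioc (0 : ℝ) θ.γ, closedBall (s : ℂ) (cS * s) ⊆ O K)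
    (hsmall2 : 2 * (c.C3act * c.ε₁) * Real.exp (5 * r₁ + 1) * K₀ 64 8 * 9 * 64 ≤ 1)
    (Tc : (K : ℕ) → GenTermFun (F.P K) 𝔸 M L)
    (hagree : ∀ (K k : ℕ) (old : OlderTerms (F.P K) 𝔸 M k), old ∈ AdmHist (sp K) E₀ r₁ k ∧ old 0 = 0 → ∀ (X : (domSys (F.P K) M (k + 1)).Dom), ∀ φ ∈ sp K (k + 1) X,
      ∀ Z : (domSys (F.P K) M (k + 1)).Dom, Subtype.val Z ⊆ Subtype.val X → ∀ s ∈ terms L M Z, ∀ t ∈ Ioc (0 : ℝ) θ.γ,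
        Tc K k Z s ((t : ℝ) : ℂ) old φ = (𝔇 K k).TF Z s ((t : ℝ) : ℂ) old φ)
    (T₀ : (K k : ℕ) → (domSys (F.P K) M (k + 1)).Dom → TermLabel (F.P K) M k L → OlderTerms (F.P K) 𝔸 M k → CPair (F.P K) 𝔸 → ℂ) {Cq : ℝ} (hCq : 0 ≤ Cq)
    (hBqv : 2 * (Real.exp 1 * 9 * 64 * K₀ 64 8 ^ 2 * (2 * (c.C3act * c.ε₁))) * Cq * (1 + cS) ^ 2 ≤ Bq)
    (hTh : ∀ (K k : ℕ) (old : OlderTerms (F.P K) 𝔸 M k), old ∈ AdmHist (sp K) E₀ r₁ k ∧ old 0 = 0 → ∀ (X : (domSys (F.P K) M (k + 1)).Dom), ∀ φ ∈ sp K (k + 1) X,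
      ∀ Z : (domSys (F.P K) M (k + 1)).Dom, Subtype.val Z ⊆ Subtype.val X → ∀ s ∈ terms L M Z, DifferentiableOn ℂ (fun z => Tc K k Z s z old φ) (O K))
    (hT226 : ∀ (K k : ℕ) (old : OlderTerms (F.P K) 𝔸 M k), old ∈ AdmHist (sp K) E₀ r₁ k ∧ old 0 = 0 → ∀ (X : (domSys (F.P K) M (k + 1)).Dom), ∀ φ ∈ sp K (k + 1) X,
      ∀ Z : (domSys (F.P K) M (k + 1)).Dom, Subtype.val Z ⊆ Subtype.val X → ∀ s ∈ terms L M Z, ∀ z ∈ O K,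
        ‖Tc K k Z s z old φ‖ ≤ weight L M c Z a s * Real.exp (a₅ * ((Z.1).card : ℝ)))
    (hT₀ : ∀ (K k : ℕ) (old : OlderTerms (F.P K) 𝔸 M k), old ∈ AdmHist (sp K) E₀ r₁ k ∧ old 0 = 0 → ∀ (X : (domSys (F.P K) M (k + 1)).Dom), ∀ φ ∈ sp K (k + 1) X,
      ∀ Z : (domSys (F.P K) M (k + 1)).Dom, Subtype.val Z ⊆ Subtype.val X → ∀ s ∈ terms L M Z, ‖T₀ K k Z s old φ‖ ≤ weight L M c Z a s * Real.exp (a₅ * ((Z.1).card : ℝ)))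
    (hTq : ∀ (K k : ℕ) (old : OlderTerms (F.P K) 𝔸 M k), old ∈ AdmHist (sp K) E₀ r₁ k ∧ old 0 = 0 → ∀ (X : (domSys (F.P K) M (k + 1)).Dom), ∀ φ ∈ sp K (k + 1) X,
      ∀ Z : (domSys (F.P K) M (k + 1)).Dom, Subtype.val Z ⊆ Subtype.val X → ∀ s ∈ terms L M Z, ∀ z ∈ O K,
        ‖Tc K k Z s z old φ - T₀ K k Z s old φ‖ ≤ Cq * ‖z‖ ^ 2 * (weight L M c Z a s * Real.exp (a₅ * ((Z.1).card : ℝ))))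
    (hlamq : Bq * θ.γ / cS ≤ ℓ₁) (hℓ₁ : 0 ≤ ℓ₁) (hω₁ : 0 ≤ ω₁)
    (Ec : ℕ → ℕ → Type*) [∀ K k, NormedAddCommGroup (Ec K k)] [∀ K k, NormedSpace ℂ (Ec K k)]
    (ι : letI := θ.instVβ₁; letI := θ.instVβ₂
      (K k : ℕ) → (domSys (F.P K) M (k + 1)).Dom → ((Fin (F.P K).d → Site (F.P K) (k + 1) → θ.Vβ) →L[ℝ] Ec K k))
    (Φ : (K k : ℕ) → (domSys (F.P K) M (k + 1)).Dom → Ec K k → CPair (F.P K) 𝔸)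
    (U : (K k : ℕ) → (domSys (F.P K) M (k + 1)).Dom → Set (Ec K k)) (hU : ∀ K k X, IsOpen (U K k X)) (hrU : ∀ K k X, ball (0 : Ec K k) r ⊆ U K k X)
    (hΦhol : ∀ (K k : ℕ) (X : (domSys (F.P K) M (k + 1)).Dom), DifferentiableOn ℂ (Φ K k X) (U K k X))
    (hΦemb : letI := θ.instVβ₁; letI := θ.instVβ₂
      ∀ (K k : ℕ) (X : (domSys (F.P K) M (k + 1)).Dom) (Bf : Fin (F.P K).d → Site (F.P K) (k + 1) → θ.Vβ),
        Φ K k X (ι K k X Bf) = emb K k (fun l t => NormedSpace.exp (θ.ρ8 (Bf l t))))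
    (hΦsp : ∀ (K k : ℕ) (X : (domSys (F.P K) M (k + 1)).Dom), ∀ z ∈ U K k X, ∀ Z : (domSys (F.P K) M (k + 1)).Dom, Z.1 ⊆ X.1 → Φ K k X z ∈ sp K (k + 1) Z)
    (w : (K k : ℕ) → (domSys (F.P K) M (k + 1)).Dom → Site (F.P K) (k + 1) → ℝ) (hw₀ : ∀ K k X t, 0 ≤ w K k X t)
    (hw : letI := θ.instVβ₁; letI := θ.instVβ₂; letI := θ.instιβ
      ∀ (K k : ℕ) (X : (domSys (F.P K) M (k + 1)).Dom) (l : Fin (F.P K).d) (t : Site (F.P K) (k + 1)) (c : θ.ιβ),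
        ‖ι K k X (Pi.single l (Pi.single t (θ.bV c)))‖ ≤ w K k X t)
    (htail : ∀ (K k : ℕ) (X : (domSys (F.P K) M (k + 1)).Dom) (t : Site (F.P K) (k + 1)),
      let e : Site (F.P K) (k + 1) → TPt 4 (domCount (F.P K) M (k + 1) * M) := fun x i => (ZMod.cast (x i) : ZMod (domCount (F.P K) M (k + 1) * M))
      w K k X t ≤ B₃ * Real.exp (-δ₀ * distCT (domCount (F.P K) M (k + 1)) M (e t) (nearT (M := M) (e t) X)))
    (hω₁μ : ω₁ ≤ μ) (hCμ : 4 * Mb * cw / ϱ ≤ μ) (hμω : μ ≤ ℓ.ω) (hℓκ : ℓ.κ ≤ delta1 δ₀ κ ((M : ℝ) * 4))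
    (hrow : 16 * B₃ ^ 2 / r ^ 2 * Real.exp (delta1 δ₀ κ ((M : ℝ) * 4) * ((M : ℝ) * 4) * 3) * K₀ (4 * 2 ^ 4) (2 * 4) * K₁ 4 (δ₀ / 2) * ℓ₁ ≤ ℓ.C₉ * ℓ.ω) :
    NE9 ((objectsOfRecord₁₃ F N θ ℓ).EA 0) (Window θ.γ) ℓ.κ ℓ.moduli := by
  -- the continued generator `GenTower.ofTerms L (Tc K)` agrees with `(𝔇 K).Gn` at every real window coupling on the class (§0 + `hagree`)
  have hE : ∀ (K k : ℕ) (old : OlderTerms (F.P K) 𝔸 M k), old ∈ AdmHist (sp K) E₀ r₁ k ∧ old 0 = 0 → ∀ (X : (domSys (F.P K) M (k + 1)).Dom), ∀ φ ∈ sp K (k + 1) X,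
      ∀ t ∈ Ioc (0 : ℝ) θ.γ, (GenTower.ofTerms L (Tc K) k).E ((t : ℝ) : ℂ) old φ X = ((𝔇 K).Gn k).E ((t : ℝ) : ℂ) old φ X :=
    fun K k old hold X φ hφ t ht => E_ofTerms_congr_of_subset L X fun Z hZ s hs => hagree K k old hold X φ hφ Z hZ s hs t ht
  -- the continued generator's last-coupling sector rows from the per-term letters (n10-c 109B §2, generic in the term family)
  have hsec := lastCouplingSectors_ofTerms_of_termSectors F L Tc T₀ (fun K k => sp K (k + 1)) (fun K k old => old ∈ AdmHist (sp K) E₀ r₁ k ∧ old 0 = 0) O c hL hLc hN hA0 hr₁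
    hCq hrate hsmall2 hO hballS hTh hT226 hT₀ hTq
  -- Cauchy at first order on the relative discs (J59 §2) for the continued generator, transported to `(𝔇 K).Gn` at the two real couplings
  exact ne9_EA_objectsOfRecord₁₃_of_termDataTableGermsLocatedRadiiRoad1Max F N
    θ ℓ hs hγ hlim m' M hM 𝔇 emb hloc sp hsp hκ₀ hδ₀ hB₃ hr hκE hE₀ big hbigo hrestr hbig c hL hLc hκ₁ hα₆ hN hloc18 hD χu χcu 𝒲 𝒪 Rd W hlaw hread hmaps hW hcont hjc
      hK hμ hCk hmk hWm hb hbaw hι hA0 hr₁ hrate hKP hrenew hrenewE hawcw hawω hϱ hR (lam := fun _ _ => Bq * θ.γ / cS)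
    (fun K k t ht t' ht' old hold X φ hφ => by
      rw [← hE K k old hold X φ hφ t ht, ← hE K k old hold X φ hφ t' ht']
      exact genT1last_of_lastSectorHolo (GenTower.ofTerms L (Tc K)) (fun k => sp K (k + 1)) (fun k old => old ∈ AdmHist (sp K) E₀ r₁ k ∧ old 0 = 0)
        (fun k old φ X => (GenTower.ofTerms L (fun k Z s (_ : ℂ) old φ => T₀ K k Z s old φ) k).E 0 old φ X) hcS hBq (hballS K) (hsec.1 K)
        (fun k old hold X φ hφ s hs' z hz => (hsec.2.2 K k old hold X φ hφ s hs' z hz).trans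
          (mul_le_mul_of_nonneg_right (mul_le_mul_of_nonneg_right hBqv (Real.exp_nonneg _)) (sq_nonneg _))) k t ht t' ht' old hold X φ hφ)
    (fun _ _ => hlamq) hℓ₁ hω₁ Ec ι Φ U hU hrU hΦhol hΦemb hΦsp w hw₀ hw htail hω₁μ hCμ hμω hℓκ
      hrow

/-! ## §2 ★★★ The kernel-face socket on ROAD 1 -/

open Classical Finset in
/-- ★★★ **THE ROAD-1 KERNEL-FACE SOCKET WITH PER-TERM LAST-COUPLING LETTERS OF A CONTINUED TERM FAMILY** — §1's inputs ⟹ **`N22At (u3OfRecord₁₃ θ (objectsOfRecord₁₃ F N θ ℓ) k)`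
for EVERY run length `k`** (dag-n27-c's `h22` row; plug = J77 §2's shape with `hGt hlam ↦ O hO hcS hBq hballS hsmall2 Tc hagree T₀ hCq hBqv hTh hT226 hT₀ hTq hlamq`).  LOCATED
(hypothesis form); N22 NOT discharged. [folklore] -/
theorem n22At_u3OfRecord₁₃_of_termDataTableGermsLocatedRadiiTermSectorsRoad1Max (θ : Stage13Params F N) (ℓ : U3Letters₁₁) (hs : ℓ.Signs) (hγ : 0 < θ.γ) (hlim : PolLimitsExistOfRecord₁₃ F N θ)
    (m' : ℕ) (M : ℕ) [NeZero M] (hM : M = F.L ^ m')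
    {c₀ : B13.Consts} {L : ℕ} [NeZero L] (𝔇 : (K : ℕ) → TermData214 c₀ (F.P K) 𝔸 M L) (emb : ReadingMaps F (MatA N) 𝔸)
    (hloc : Localizes17OfRecord₁₃ F N θ (fun K => truncRun K (toClusterTower (𝔇 K).Gn)) emb)
    (sp : (K j : ℕ) → (domSys (F.P K) M j).Dom → Set (CPair (F.P K) 𝔸))
    (hsp : ∀ (K j : ℕ) (Y : (domSys (F.P K) M j).Dom), IsOpen (sp K j Y))
    {κ δ₀ B₃ r ℓ₁ R E₀ ϱ Mb cw ω₁ μ r₁ cS Bq : ℝ} {aw : ℕ → ℕ → ℕ → ℝ}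
    (hκ₀ : kappa₀ (4 * 2 ^ 4) (2 * 4) ≤ κ / 2) (hδ₀ : 0 < δ₀) (hB₃ : 0 ≤ B₃) (hr : 0 < r) (hκE : κ ≤ r₁) (hE₀ : 0 ≤ E₀)
    (big : (K j : ℕ) → (domSys (F.P K) M j).Dom → Set (CPair (F.P K) 𝔸))
    (hbigo : ∀ (K k : ℕ) (Z : (domSys (F.P K) M (k + 1)).Dom), IsOpen (big K (k + 1) Z))
    (hrestr : ∀ (K k : ℕ), SpRestr (sp K (k + 1))) (hbig : ∀ (K k : ℕ) (Z : (domSys (F.P K) M (k + 1)).Dom), sp K (k + 1) Z ⊆ big K (k + 1) Z)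
    (c : B13.Consts) (hL : 8 ≤ c.L) (hLc : c.L = L) (hκ₁ : 1 ≤ c.κ₁) (hα₆ : c.α₆ ≠ 0) {a a₂ a₂' a₅ Aabs : ℝ} (hN : Lemma3Numerics c M ((c.L : ℝ) / 2) a a₂ a₂' a₅ Aabs)
    {D : ℕ → Set ℂ}
    (hloc18 : ∀ (K k : ℕ), ∀ s ∈ D K, ∀ old : OlderTerms (F.P K) 𝔸 M k,
      (∀ (j : Fin (k + 1)) (Y : (domSys (F.P K) M j).Dom), ∀ ψ ∈ sp K j Y, ‖old j Y ψ‖ ≤ E₀ * Real.exp (-(r₁ * (domSys (F.P K) M j).dj Y))) →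
      (∀ (j : Fin (k + 1)) (Y : (domSys (F.P K) M j).Dom), AnalyticOnNhd ℂ (old j Y) (sp K j Y)) →
      ∀ (Z : (domSys (F.P K) M (k + 1)).Dom), ∀ t ∈ terms L M Z, ∀ φ₁ ∈ big K (k + 1) Z, ∃ ι : (𝔇 K k).Inputs226Holo c Z t s old φ₁ a a₅,
        (∀ φ ∈ big K (k + 1) Z, ∀ i j, DifferentiableOn ℂ (fun σ => (𝔇 K k).A Z t φ σ i j) {σ | ∀ j, σ j ∈ ι.Uσ}) ∧
        (∀ φ ∈ big K (k + 1) Z, ∀ i j, DifferentiableOn ℂ (fun σ => ((𝔇 K k).𝒦 Z t).G2 σ ((𝔇 K k).uOf Z t φ) i j) {σ | ∀ j, σ j ∈ ι.Uσ}) ∧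
        (∀ σ : TPt (F.P K).d (domCount (F.P K) M (k + 1)) → ℂ, (∀ j, σ j ∈ ι.Uσ) → ∀ i j, DifferentiableOn ℂ (fun φ => (𝔇 K k).A Z t φ σ i j) (big K (k + 1) Z)) ∧
        (∀ σ : TPt (F.P K).d (domCount (F.P K) M (k + 1)) → ℂ, (∀ j, σ j ∈ ι.Uσ) →
          ∀ i j, DifferentiableOn ℂ (fun φ => ((𝔇 K k).𝒦 Z t).G2 σ ((𝔇 K k).uOf Z t φ) i j) (big K (k + 1) Z)) ∧
        (∀ Y B, DifferentiableOn ℂ (fun φ => (𝔇 K k).𝒱 Z t s old φ Y B) (big K (k + 1) Z)) ∧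
        (∀ φ ∈ big K (k + 1) Z, ∀ Y, Measurable ((𝔇 K k).𝒱 Z t s old φ Y)) ∧
        (∀ φ ∈ big K (k + 1) Z, ∀ σ : TPt (F.P K).d (domCount (F.P K) M (k + 1)) → ℂ, (∀ j, σ j ∈ ι.Uσ) → ((𝔇 K k).A Z t φ σ).IsSymm) ∧
        (∀ φ ∈ big K (k + 1) Z, ∀ σ : TPt (F.P K).d (domCount (F.P K) M (k + 1)) → ℂ, (∀ j, σ j ∈ ι.Uσ) → (((𝔇 K k).A Z t φ σ).map Complex.re).PosDef) ∧
        (∀ φ ∈ big K (k + 1) Z, ∀ τ : TDom (F.P K).d (L * domCount (F.P K) M (k + 1)) → ℂ, (∀ Y, τ Y ∈ ι.Uτ Y) →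
          ∀ B, ∑ Y ∈ t.1, ‖τ Y‖ * ‖(𝔇 K k).𝒱 Z t s old φ Y B‖ ≤ ι.a₂₀ / 2 * (B ⬝ᵥ B) + ι.w) ∧
        (∀ φ ∈ big K (k + 1) Z, ∀ σ : TPt (F.P K).d (domCount (F.P K) M (k + 1)) → ℂ, (∀ j, σ j ∈ ι.Uσ) → ∀ b j, ‖((𝔇 K k).𝒦 Z t).G2 σ ((𝔇 K k).uOf Z t φ) b j‖ ≤
            ι.KG * Real.exp (-(ι.kap * tdist1 (𝔇 K k).Nf (((𝔇 K k).𝒦 Z t).locΛ b) (((𝔇 K k).𝒦 Z t).locN j)))) ∧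
        (∀ φ ∈ big K (k + 1) Z, ∀ σ : TPt (F.P K).d (domCount (F.P K) M (k + 1)) → ℂ, (∀ j, σ j ∈ ι.Uσ) → ∀ b b', ‖((𝔇 K k).A Z t φ σ)⁻¹ b b'‖ ≤
            ι.KCs * Real.exp (-(ι.kap * tdist1 (𝔇 K k).Nf (((𝔇 K k).𝒦 Z t).locΛ b) (((𝔇 K k).𝒦 Z t).locΛ b')))) ∧
        (∀ φ ∈ big K (k + 1) Z, ∀ σ : TPt (F.P K).d (domCount (F.P K) M (k + 1)) → ℂ, (∀ j, σ j ∈ ι.Uσ) →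
          ∀ b j, ‖(((𝔇 K k).𝒦 Z t).G2 σ ((𝔇 K k).uOf Z t φ) - ((𝔇 K k).𝒦 Z t).Γ₀.map (algebraMap ℝ ℂ)) b j‖ ≤
            ι.θΓ * Real.exp (-(ι.kap * tdist1 (𝔇 K k).Nf (((𝔇 K k).𝒦 Z t).locΛ b) (((𝔇 K k).𝒦 Z t).locN j)))) ∧
        (∀ φ ∈ big K (k + 1) Z, ∀ σ : TPt (F.P K).d (domCount (F.P K) M (k + 1)) → ℂ, (∀ j, σ j ∈ ι.Uσ) →
          ∀ b b', ‖(((𝔇 K k).A Z t φ σ)⁻¹ - ((𝔇 K k).𝒦 Z t).C.map (algebraMap ℝ ℂ)) b b'‖ ≤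
            ι.θC * Real.exp (-(ι.kap * tdist1 (𝔇 K k).Nf (((𝔇 K k).𝒦 Z t).locΛ b) (((𝔇 K k).𝒦 Z t).locΛ b')))) ∧
        (∀ φ ∈ big K (k + 1) Z, ∀ σ : TPt (F.P K).d (domCount (F.P K) M (k + 1)) → ℂ, (∀ j, σ j ∈ ι.Uσ) →
          ∀ b b', ‖((𝔇 K k).A Z t φ σ - ((𝔇 K k).𝒦 Z t).C⁻¹.map (algebraMap ℝ ℂ)) b b'‖ ≤
            ι.θE * Real.exp (-(ι.kap * tdist1 (𝔇 K k).Nf (((𝔇 K k).𝒦 Z t).locΛ b) (((𝔇 K k).𝒦 Z t).locΛ b')))))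
    (hD : ∀ K, ∀ t ∈ Ioc (0 : ℝ) θ.γ, ((t : ℝ) : ℂ) ∈ D K)
    {S : ℕ → ℕ → Type} [∀ K k, MeasurableSpace (S K k)] [∀ K k, TopologicalSpace (S K k)] [∀ K k, OpensMeasurableSpace (S K k)]
    (χu χcu : (K k : ℕ) → (𝔇 K k).UnscaledChi) (𝒲 : (K k : ℕ) → (𝔇 K k).UnscaledWilson) (𝒪 : (K k : ℕ) → (𝔇 K k).UnscaledOlder)
    (Rd : (K k : ℕ) → (Z : (domSys (F.P K) M (k + 1)).Dom) → (t : TermLabel (F.P K) M k L) → (𝔇 K k).ReadingAtoms Z t (S K k))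
    (W : (K k : ℕ) → (domSys (F.P K) M (k + 1)).Dom → TermLabel (F.P K) M k L → Set (CPair (F.P K) 𝔸))
    (hlaw : ∀ K, (𝔇 K).UnscaledFieldLawOn (χu K) (χcu K) (𝒲 K) (𝒪 K) θ.γ) (hread : ∀ K k, (𝔇 K k).ReadsBy (𝒪 K k) (Rd K k))
    (hmaps : ∀ (K k : ℕ) (Z : (domSys (F.P K) M (k + 1)).Dom) (t : TermLabel (F.P K) M k L), (Rd K k Z t).MapsToTables (sp K) (W K k Z t) univ)
    (hW : ∀ (K k : ℕ) (X Z : (domSys (F.P K) M (k + 1)).Dom), Subtype.val Z ⊆ Subtype.val X → ∀ s ∈ terms L M Z, sp K (k + 1) X ⊆ W K k Z s)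
    (hcont : ∀ (K k : ℕ) (Z : (domSys (F.P K) M (k + 1)).Dom) (t : TermLabel (F.P K) M k L), (Rd K k Z t).CfgContinuous)
    (hjc : ∀ (K k : ℕ) (Z : (domSys (F.P K) M (k + 1)).Dom) (t : TermLabel (F.P K) M k L), (Rd K k Z t).CfgJointContinuous)
    {Ck mk : ℝ} (hK : ∀ (K k : ℕ) (Z : (domSys (F.P K) M (k + 1)).Dom) (t : TermLabel (F.P K) M k L), (Rd K k Z t).KernelBounded Ck)
    (hμ : ∀ (K k : ℕ) (Z : (domSys (F.P K) M (k + 1)).Dom) (t : TermLabel (F.P K) M k L), (Rd K k Z t).FiniteMass mk) (hCk : 0 ≤ Ck) (hmk : 0 ≤ mk)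
    (hWm : ∀ (K k : ℕ) (Z : (domSys (F.P K) M (k + 1)).Dom) (t : TermLabel (F.P K) M k L) (φ : CPair (F.P K) 𝔸) (Y : TDom (F.P K).d (L * domCount (F.P K) M (k + 1))),
      Measurable fun B : ((𝔇 K k).𝒦 Z t).Λ → ℝ => 𝒲 K k Z t φ Y B)
    {b : ℝ} (hb : 0 < b) (hbaw : ∀ K k j, b ≤ aw K k j)
    (hι : ∀ (K k : ℕ), ∀ t ∈ Ioc (0 : ℝ) θ.γ, ∀ (X : (domSys (F.P K) M (k + 1)).Dom), ∀ φ ∈ sp K (k + 1) X,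
      ∀ Z : (domSys (F.P K) M (k + 1)).Dom, Subtype.val Z ⊆ Subtype.val X → ∀ s ∈ terms L M Z,
        ∃ old₀ ∈ AdmHist (sp K) E₀ r₁ k, ∃ ι : (𝔇 K k).Inputs226Holo c Z s ((t : ℝ) : ℂ) old₀ φ a a₅, ∃ w₀ : ℝ,
          (∀ τ : TDom (F.P K).d (L * domCount (F.P K) M (k + 1)) → ℂ, (∀ Y, τ Y ∈ ι.Uτ Y) → ∀ B : ((𝔇 K k).𝒦 Z s).Λ → ℝ,
            ∑ Y ∈ s.1, ‖τ Y‖ * ‖(𝔇 K k).𝒱 Z s ((t : ℝ) : ℂ) old₀ φ Y B‖ ≤ ι.a₂₀ / 2 * (B ⬝ᵥ B) + w₀) ∧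
          w₀ + (∑ Y ∈ s.1, ((B13Bound143.invTau c ((tsys (F.P K).d (L * domCount (F.P K) M (k + 1))).dj Y))⁻¹ + (𝔇 K k).r + 2)) *
            ((∑ _j : Fin (k + 1), ∑ _X : (domSys (F.P K) M _j).Dom, Ck) * mk * (E₀ + b⁻¹ * R)) ≤ ι.w)
    (hA0 : 0 ≤ c.C3act * c.ε₁) (hr₁ : 0 ≤ r₁) (hrate : r₁ + 2 * (64 * Real.log 162) + 2 ≤ (1 - 8 * c.δ) * ((c.L : ℝ) / 2) * c.κ)
    (hKP : c.C3act * c.ε₁ * Real.exp (5 * r₁ + 1) * K₀ 64 8 * 9 * 64 < 1) (hrenew : Real.exp 1 * 9 * 64 * K₀ 64 8 ^ 2 * (c.C3act * c.ε₁) ≤ Mb)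
    (hrenewE : Real.exp 1 * 9 * 64 * K₀ 64 8 ^ 2 * (c.C3act * c.ε₁) ≤ E₀)
    (hawcw : ∀ K k j, aw K k j ≤ cw) (hawω : ∀ K k j, j ≤ k → aw K k j ≤ cw * ω₁ ^ (k - j)) (hϱ : 0 < ϱ) (hR : cw * E₀ + ϱ < R)
    (O : ℕ → Set ℂ) (hO : ∀ K, IsOpen (O K)) (hcS : 0 < cS) (hBq : 0 ≤ Bq)
    (hballS : ∀ K, ∀ s ∈ Ioc (0 : ℝ) θ.γ, closedBall (s : ℂ) (cS * s) ⊆ O K)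
    (hsmall2 : 2 * (c.C3act * c.ε₁) * Real.exp (5 * r₁ + 1) * K₀ 64 8 * 9 * 64 ≤ 1)
    (Tc : (K : ℕ) → GenTermFun (F.P K) 𝔸 M L)
    (hagree : ∀ (K k : ℕ) (old : OlderTerms (F.P K) 𝔸 M k), old ∈ AdmHist (sp K) E₀ r₁ k ∧ old 0 = 0 → ∀ (X : (domSys (F.P K) M (k + 1)).Dom), ∀ φ ∈ sp K (k + 1) X,
      ∀ Z : (domSys (F.P K) M (k + 1)).Dom, Subtype.val Z ⊆ Subtype.val X → ∀ s ∈ terms L M Z, ∀ t ∈ Ioc (0 : ℝ) θ.γ,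
        Tc K k Z s ((t : ℝ) : ℂ) old φ = (𝔇 K k).TF Z s ((t : ℝ) : ℂ) old φ)
    (T₀ : (K k : ℕ) → (domSys (F.P K) M (k + 1)).Dom → TermLabel (F.P K) M k L → OlderTerms (F.P K) 𝔸 M k → CPair (F.P K) 𝔸 → ℂ) {Cq : ℝ} (hCq : 0 ≤ Cq)
    (hBqv : 2 * (Real.exp 1 * 9 * 64 * K₀ 64 8 ^ 2 * (2 * (c.C3act * c.ε₁))) * Cq * (1 + cS) ^ 2 ≤ Bq)
    (hTh : ∀ (K k : ℕ) (old : OlderTerms (F.P K) 𝔸 M k), old ∈ AdmHist (sp K) E₀ r₁ k ∧ old 0 = 0 → ∀ (X : (domSys (F.P K) M (k + 1)).Dom), ∀ φ ∈ sp K (k + 1) X,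
      ∀ Z : (domSys (F.P K) M (k + 1)).Dom, Subtype.val Z ⊆ Subtype.val X → ∀ s ∈ terms L M Z, DifferentiableOn ℂ (fun z => Tc K k Z s z old φ) (O K))
    (hT226 : ∀ (K k : ℕ) (old : OlderTerms (F.P K) 𝔸 M k), old ∈ AdmHist (sp K) E₀ r₁ k ∧ old 0 = 0 → ∀ (X : (domSys (F.P K) M (k + 1)).Dom), ∀ φ ∈ sp K (k + 1) X,
      ∀ Z : (domSys (F.P K) M (k + 1)).Dom, Subtype.val Z ⊆ Subtype.val X → ∀ s ∈ terms L M Z, ∀ z ∈ O K,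
        ‖Tc K k Z s z old φ‖ ≤ weight L M c Z a s * Real.exp (a₅ * ((Z.1).card : ℝ)))
    (hT₀ : ∀ (K k : ℕ) (old : OlderTerms (F.P K) 𝔸 M k), old ∈ AdmHist (sp K) E₀ r₁ k ∧ old 0 = 0 → ∀ (X : (domSys (F.P K) M (k + 1)).Dom), ∀ φ ∈ sp K (k + 1) X,
      ∀ Z : (domSys (F.P K) M (k + 1)).Dom, Subtype.val Z ⊆ Subtype.val X → ∀ s ∈ terms L M Z, ‖T₀ K k Z s old φ‖ ≤ weight L M c Z a s * Real.exp (a₅ * ((Z.1).card : ℝ)))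
    (hTq : ∀ (K k : ℕ) (old : OlderTerms (F.P K) 𝔸 M k), old ∈ AdmHist (sp K) E₀ r₁ k ∧ old 0 = 0 → ∀ (X : (domSys (F.P K) M (k + 1)).Dom), ∀ φ ∈ sp K (k + 1) X,
      ∀ Z : (domSys (F.P K) M (k + 1)).Dom, Subtype.val Z ⊆ Subtype.val X → ∀ s ∈ terms L M Z, ∀ z ∈ O K,
        ‖Tc K k Z s z old φ - T₀ K k Z s old φ‖ ≤ Cq * ‖z‖ ^ 2 * (weight L M c Z a s * Real.exp (a₅ * ((Z.1).card : ℝ))))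
    (hlamq : Bq * θ.γ / cS ≤ ℓ₁) (hℓ₁ : 0 ≤ ℓ₁) (hω₁ : 0 ≤ ω₁)
    (Ec : ℕ → ℕ → Type*) [∀ K k, NormedAddCommGroup (Ec K k)] [∀ K k, NormedSpace ℂ (Ec K k)]
    (ι : letI := θ.instVβ₁; letI := θ.instVβ₂
      (K k : ℕ) → (domSys (F.P K) M (k + 1)).Dom → ((Fin (F.P K).d → Site (F.P K) (k + 1) → θ.Vβ) →L[ℝ] Ec K k))
    (Φ : (K k : ℕ) → (domSys (F.P K) M (k + 1)).Dom → Ec K k → CPair (F.P K) 𝔸)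
    (U : (K k : ℕ) → (domSys (F.P K) M (k + 1)).Dom → Set (Ec K k)) (hU : ∀ K k X, IsOpen (U K k X)) (hrU : ∀ K k X, ball (0 : Ec K k) r ⊆ U K k X)
    (hΦhol : ∀ (K k : ℕ) (X : (domSys (F.P K) M (k + 1)).Dom), DifferentiableOn ℂ (Φ K k X) (U K k X))
    (hΦemb : letI := θ.instVβ₁; letI := θ.instVβ₂
      ∀ (K k : ℕ) (X : (domSys (F.P K) M (k + 1)).Dom) (Bf : Fin (F.P K).d → Site (F.P K) (k + 1) → θ.Vβ),
        Φ K k X (ι K k X Bf) = emb K k (fun l t => NormedSpace.exp (θ.ρ8 (Bf l t))))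
    (hΦsp : ∀ (K k : ℕ) (X : (domSys (F.P K) M (k + 1)).Dom), ∀ z ∈ U K k X, ∀ Z : (domSys (F.P K) M (k + 1)).Dom, Z.1 ⊆ X.1 → Φ K k X z ∈ sp K (k + 1) Z)
    (w : (K k : ℕ) → (domSys (F.P K) M (k + 1)).Dom → Site (F.P K) (k + 1) → ℝ) (hw₀ : ∀ K k X t, 0 ≤ w K k X t)
    (hw : letI := θ.instVβ₁; letI := θ.instVβ₂; letI := θ.instιβ
      ∀ (K k : ℕ) (X : (domSys (F.P K) M (k + 1)).Dom) (l : Fin (F.P K).d) (t : Site (F.P K) (k + 1)) (c : θ.ιβ),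
        ‖ι K k X (Pi.single l (Pi.single t (θ.bV c)))‖ ≤ w K k X t)
    (htail : ∀ (K k : ℕ) (X : (domSys (F.P K) M (k + 1)).Dom) (t : Site (F.P K) (k + 1)),
      let e : Site (F.P K) (k + 1) → TPt 4 (domCount (F.P K) M (k + 1) * M) := fun x i => (ZMod.cast (x i) : ZMod (domCount (F.P K) M (k + 1) * M))
      w K k X t ≤ B₃ * Real.exp (-δ₀ * distCT (domCount (F.P K) M (k + 1)) M (e t) (nearT (M := M) (e t) X)))
    (hω₁μ : ω₁ ≤ μ) (hCμ : 4 * Mb * cw / ϱ ≤ μ) (hμω : μ ≤ ℓ.ω) (hℓκ : ℓ.κ ≤ delta1 δ₀ κ ((M : ℝ) * 4))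
    (hrow : 16 * B₃ ^ 2 / r ^ 2 * Real.exp (delta1 δ₀ κ ((M : ℝ) * 4) * ((M : ℝ) * 4) * 3) * K₀ (4 * 2 ^ 4) (2 * 4) * K₁ 4 (δ₀ / 2) * ℓ₁ ≤ ℓ.C₉ * ℓ.ω) (k : ℕ) :
    N22At (u3OfRecord₁₃ θ (objectsOfRecord₁₃ F N θ ℓ) k) :=
  (n22At_u3OfRecord₁₃_objectsOfRecord₁₃_iff F N θ ℓ hs k).2
    (ne9_EA_objectsOfRecord₁₃_of_termDataTableGermsLocatedRadiiTermSectorsRoad1Max F N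
      θ ℓ hs hγ hlim m' M hM 𝔇 emb hloc sp hsp hκ₀ hδ₀ hB₃ hr hκE hE₀ big hbigo hrestr hbig c hL hLc hκ₁ hα₆ hN hloc18 hD χu χcu 𝒲 𝒪 Rd W hlaw hread hmaps hW hcont hjc
        hK hμ hCk hmk hWm hb hbaw hι hA0 hr₁ hrate hKP hrenew hrenewE hawcw hawω hϱ hR O hO hcS hBq hballS hsmall2 Tc hagree T₀ hCq hBqv hTh hT226 hT₀ hTq hlamq
        hℓ₁ hω₁ Ec ι Φ U hU hrU hΦhol hΦemb hΦsp w hw₀ hw htail hω₁μ hCμ hμω hℓκ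
        hrow)

end YMDAG.N22.KernelFading

end
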